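import Literature.AlgebraicGeometry.HodgeTheory.HeckePrymF21WeilTwelvefoldOfRiemannExistence
import Literature.AlgebraicGeometry.Motives.JacobianExistenceComplex
import Literature.AlgebraicGeometry.Motives.JacobianFirstCohomologyHolds
import HarnessLib

/-!
# `exists_heckePrymDatum_F21` from Riemann's existence theorem and the holomorphic Lefschetz formula — WITHOUT the two Jacobian facts

Sixth proof file of the named fact `Literature.AlgebraicGeometry.HodgeTheory.exists_heckePrymDatum_F21`
(`HeckePrymF21WeilTwelvefold`: an étale `F₂₁`-cover of a complex genus-3 curve whose Hecke–Prym is a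
`ℚ(√-7)`-Weil twelvefold of type `(6,6)`; consumed by the summit route `HeckePrymWeil`, crux
`WeilTwelvefoldsSqrtMinus7`).  The fifth file (`…OfRiemannExistence`) reduced the fact to FOUR inputs:
Riemann's existence theorem for free actions with prescribed group (`hRE`, [LangeRodriguez2022,
Thm. 3.1.1]), the holomorphic Lefschetz fixed-point formula (`hL`, [AtiyahBott1968, Thm. 4.12]) — or
directly the trace `tr(σ^* | H^{0,1}(C)) = 1` of a free automorphism (`hCW`, [FarkasKra1992, Thm. V.2.9];
[ChevalleyWeil1934Integrale]) —, and the two Jacobian facts of `Motives/Jacobian`: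
`hI : isIso_bettiCohomology_map_abelJacobi` (`H¹(J(C)) ≅ H¹(C)`, [Milne1986JacobianVarieties, §2],
[Lange2023AbelianVarietiesC, §4.1.1]) and `hJ : nonempty_jacobian_of_isSmoothProjective` (Jacobians exist,
[Milne1986JacobianVarieties, Thm. 1.1]).  Both Jacobian facts are now THEOREMS of the tree in the generality
this reduction uses — `Motives.isIso_bettiCohomology_map_abelJacobi_holds` (`Motives/JacobianFirstCohomologyHolds`)
and, over `ℂ`, `Motives.nonempty_jacobian_of_isSmoothProjective_complex` (`Motives/JacobianExistenceComplex`,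
Serre's universal-morphism criterion) — so this file re-issues the three reduction theorems of the fifth
file with `hI`, `hJ` STRUCK:

* `exists_heckePrymDatum_F21_of_curve_free` — the curve-level statement: an étale `F₂₁`-curve of genus
  `43` with the holomorphic Chevalley–Weil count `6` gives the fact (was
  `exists_heckePrymDatum_F21_of_isIso_of_nonempty_jacobian_of_curve hI hJ`);
* `exists_heckePrymDatum_F21_of_riemannExistence_of_traces_free (hRE) (hCW)`;
* `exists_heckePrymDatum_F21_of_riemannExistence_of_holomorphicLefschetz_free (hRE) (hL)` — the complete
  reduction: **the named fact now rests on Riemann's existence theorem and the holomorphic Lefschetz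
  formula ALONE.**

Proofs: verbatim those of the fifth file (same steps, same cited sources), the Jacobian of the curve being
CHOSEN by `Motives.jacobian C (nonempty_jacobian_of_isSmoothProjective_complex C hC)` and `hI` being fed
`isIso_bettiCohomology_map_abelJacobi_holds`.  Theorems only; no definition, no named fact, sorry-free
(D-0026).  Written by the literature seat `pub-hodgecm-conseq` (generation 10), cross-route service
announced in `run/shared/lean/pub/pub-hodgecm/STATUS.md`.

## References

* [LangeRodriguez2022] H. Lange, R. E. Rodríguez, *Decomposition of Jacobians by Prym Varieties*, LNM 2310
  (2022), §3.1.2 Thm. 3.1.1 (PDF p. 52), §3.2 (3.5)–(3.6), §3.5 Cor. 3.5.9–3.5.10.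
* [AtiyahBott1968] M. F. Atiyah, R. Bott, *A Lefschetz fixed point formula for elliptic complexes II*,
  Ann. of Math. 88 (1968), Thm. 4.12.
* [FarkasKra1992] H. M. Farkas, I. Kra, *Riemann Surfaces*, 2nd ed., GTM 71 (1992), Thm. V.2.9 and Corollary.
* [ChevalleyWeil1934Integrale] C. Chevalley, A. Weil, *Über das Verhalten der Integrale 1. Gattung bei
  Automorphismen des Funktionenkörpers*, Abh. Math. Sem. Hamburg 10 (1934) 358–361.
* [Milne1986JacobianVarieties] J. S. Milne, *Jacobian varieties*, in: Arithmetic Geometry (1986), Thm. 1.1,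
  §2 Prop. 2.1, Thm. 2.5, §6 Prop. 6.4.
* [Lange2023AbelianVarietiesC] H. Lange, *Abelian Varieties over the Complex Numbers* (2023), §4.1.1,
  Lemma 4.4.1.
-/

noncomputable section

open scoped Manifold ContDiff
open CategoryTheory
open Literature.NumberTheory.Transcendental (hodgePQ complexDeRhamCohomology map_mem_hodgePQ)
open Literature.AlgebraicTopology.SingularHomology

namespace Literature.AlgebraicGeometry.HodgeTheory

open Literature.AlgebraicGeometry Literature.AlgebraicGeometry.Motives

/-- **`exists_heckePrymDatum_F21` from an étale `F₂₁`-curve of genus `43` with its holomorphic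
Chevalley–Weil datum — no Jacobian fact needed.** If there is a smooth projective complex curve `C`
with `b₁(C(ℂ)) = 86` and fixed-point-free automorphisms `σ⁷ = 𝟙`, `τ³ = 𝟙`, `σ ≫ τ = τ ≫ σ ≫ σ` such
that `dim (H¹(C)^τ ∩ ker(η_C - i√7) ∩ H^{1,0}(C)) = 6`, then the named fact holds: choose the Jacobian
`Motives.jacobian C _` (it EXISTS, `nonempty_jacobian_of_isSmoothProjective_complex`), of dimension
`½ b₁ = 43` by `H¹(J) ≅ H¹(C)` (`isIso_bettiCohomology_map_abelJacobi_holds`), and apply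
`exists_heckePrymDatum_F21_of_isIso_of_curve`.
[cite: LangeRodriguez2022, Thm. 3.1.1 (PDF p. 52), §3.2 (3.5)–(3.6) (PDF p. 56) and §3.5 Cor. 3.5.9–3.5.10 (PDF pp. 70–71)]
[cite: Milne1986JacobianVarieties, Thm. 1.1, Prop. 2.1 and §6 Prop. 6.4]
[cite: ChevalleyWeil1934Integrale, Satz (pp. 358–361)] -/
theorem exists_heckePrymDatum_F21_of_curve_free
    (h : ∃ (C : SchemeOver ℂ) (hC : IsSmoothProjective 1 C) (σ τ : C ⟶ C),
      Module.finrank ℂ (complexBetti C 1) = 86 ∧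
      σ ≫ σ ≫ σ ≫ σ ≫ σ ≫ σ ≫ σ = 𝟙 C ∧ τ ≫ τ ≫ τ = 𝟙 C ∧ σ ≫ τ = τ ≫ σ ≫ σ ∧
      (∀ P : ComplexPoints C, P ≫ σ ≠ P ∧ P ≫ τ ≠ P) ∧
      Module.finrank ℂ ↥(LinearMap.ker ((complexBetti.map τ 1).hom - 1) ⊓
        Module.End.eigenspace ((complexBetti.map σ 1).hom + (complexBetti.map σ 1).hom ^ 2 +
            (complexBetti.map σ 1).hom ^ 4 - (complexBetti.map σ 1).hom ^ 3 -
            (complexBetti.map σ 1).hom ^ 5 - (complexBetti.map σ 1).hom ^ 6)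
          (Complex.I * (Real.sqrt (7 : ℝ) : ℂ)) ⊓ hodgeOneZero hC) = 6) :
    exists_heckePrymDatum_F21 := by
  obtain ⟨C, hC, σ, τ, h86, hσ, hτ, hστ, hfree, h6⟩ := h
  let 𝒥 : Jacobian C := Motives.jacobian C (nonempty_jacobian_of_isSmoothProjective_complex C hC)
  have hI : isIso_bettiCohomology_map_abelJacobi := isIso_bettiCohomology_map_abelJacobi_holds
  have hdim : 𝒥.J.dim = 43 := by
    have h := Motives.two_mul_dim_eq_finrank_bettiCohomology_of_isIso hI C hC 𝒥
    rw [← finrank_complexBetti_eq_finrank_bettiCohomology, h86] at h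
    omega
  exact exists_heckePrymDatum_F21_of_isIso_of_curve hI ⟨C, hC, 𝒥, σ, τ, hdim, hσ, hτ, hστ, hfree, h6⟩

/-- **`exists_heckePrymDatum_F21` from Riemann's existence theorem and the Chevalley–Weil / Eichler trace
`tr(σ^* | H^{0,1}(C)) = 1` for free automorphisms — no Jacobian fact needed.** Hypotheses: `hRE` —
Riemann's existence theorem for free actions with prescribed group ([LangeRodriguez2022, Thm. 3.1.1 (⇐),
`s = 0`]); `hCW` — for an automorphism `σ` WITHOUT fixed points of a smooth projective complex curve of
genus `≥ 2`, `tr(σ^* | H^{0,1}(C)) = 1` (Eichler's trace formula [FarkasKra1992, Thm. V.2.9] at `t = 0`,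
equivalently the holomorphic Chevalley–Weil character [ChevalleyWeil1934Integrale]).  Proof as in
`exists_heckePrymDatum_F21_of_riemannExistence_of_traces` (§4 of `…OfRiemannExistence` gives the free
`F₂₁`-curve of genus `43`, §3 the holomorphic count `6`), concluded by
`exists_heckePrymDatum_F21_of_curve_free`.
[cite: LangeRodriguez2022, §3.1.2 Thm. 3.1.1 (PDF p. 52), §3.2 (3.5)–(3.6) (PDF p. 56) and §3.5 Cor. 3.5.9–3.5.10 (PDF pp. 70–71)]
[cite: FarkasKra1992, Thm. V.2.9 and Corollary (PDF p. 243)] [cite: ChevalleyWeil1934Integrale, Satz (pp. 358–361)] -/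
theorem exists_heckePrymDatum_F21_of_riemannExistence_of_traces_free
    (hRE : ∀ (G : Type) [Group G] [Finite G] (g' : ℕ) (a b : Fin g' → G), 2 ≤ g' →
      Subgroup.closure (Set.range a ∪ Set.range b) = ⊤ →
      (List.ofFn fun i => a i * b i * (a i)⁻¹ * (b i)⁻¹).prod = 1 →
      ∃ (C : Motives.SchemeOver ℂ) (_ : IsSmoothProjective 1 C) (ρ : G →* Aut C),
        (∀ g : G, g ≠ 1 → ∀ P : ComplexPoints C, P ≫ (ρ g).hom ≠ P) ∧
        Literature.NumberTheory.DiophantineGeometry.genus C = 1 + Nat.card G * (g' - 1))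
    (hCW : ∀ (C : Motives.SchemeOver ℂ) (hC : IsSmoothProjective 1 C) (σ : C ≅ C),
      2 ≤ Literature.NumberTheory.DiophantineGeometry.genus C →
      (∀ P : ComplexPoints C, P ≫ σ.hom ≠ P) →
      LinearMap.trace ℂ ↥(hodgeZeroOne hC)
        ((complexBetti.map σ.hom 1).hom.restrict fun _ hx => map_mem_hodgeZeroOne hC σ.hom hx) = 1) :
    exists_heckePrymDatum_F21 := by
  obtain ⟨C, hC, G, _, ρ, s, t, hs, ht, hts, hne, hfree, hg⟩ := exists_curve_F21_of_riemannExistence hRE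
  haveI := finite_complexBetti_of_isSmoothProjective hC 1
  -- genus bookkeeping: `h^{1,0} = h^{0,1} = 43`, `b₁ = 86`
  have h10 : Module.finrank ℂ (hodgeOneZero hC) = 43 := by rw [finrank_hodgeOneZero_eq_genus hC, hg]
  have h01 : Module.finrank ℂ (hodgeZeroOne hC) = 43 := by
    rw [← finrank_hodgeOneZero_eq_finrank_hodgeZeroOne hC, h10]
  have h86 : Module.finrank ℂ (complexBetti C 1) = 86 := by
    rw [finrank_complexBetti_one_eq_two_mul_finrank_hodgeOneZero hC, h10]
  have hg2 : 2 ≤ Literature.NumberTheory.DiophantineGeometry.genus C := by rw [hg]; norm_num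
  -- the traces on `H^{0,1}` and the holomorphic count
  have htr : ∀ g : G, g ≠ 1 → LinearMap.trace ℂ ↥(hodgeZeroOne hC)
      ((complexBetti.map (ρ g).hom 1).hom.restrict fun _ hx => map_mem_hodgeZeroOne hC (ρ g).hom hx) = 1 :=
    fun g hg1 => hCW C hC (ρ g) hg2 (hfree g hg1)
  have h6 := finrank_inf_hodgeOneZero_eq_six_of_traces hC ρ s t hs ht hts hne h01 htr
  -- the relations as morphisms
  have hs1 : s ≠ 1 := fun h => hne 1 (by norm_num) 0 (by norm_num) (Or.inl one_ne_zero)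
    (by rw [h, one_pow, pow_zero, one_mul])
  have ht1 : t ≠ 1 := fun h => hne 0 (by norm_num) 1 (by norm_num) (Or.inr one_ne_zero)
    (by rw [h, one_pow, pow_zero, mul_one])
  have hσ7 : (ρ s).hom ≫ (ρ s).hom ≫ (ρ s).hom ≫ (ρ s).hom ≫ (ρ s).hom ≫ (ρ s).hom ≫ (ρ s).hom = 𝟙 C := by
    rw [← aut_pow_seven_hom, ← map_pow, hs, map_one]
    rfl
  have hτ3 : (ρ t).hom ≫ (ρ t).hom ≫ (ρ t).hom = 𝟙 C := by
    rw [← aut_pow_three_hom, ← map_pow, ht, map_one]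
    rfl
  have hστ : (ρ s).hom ≫ (ρ t).hom = (ρ t).hom ≫ (ρ s).hom ≫ (ρ s).hom := by
    have e := congrArg (fun g => (ρ g).hom) hts
    simp only [map_mul, Aut.Aut_mul_def, Iso.trans_hom, pow_succ, pow_zero, one_mul] at e
    exact e
  have hfree' : ∀ P : ComplexPoints C, P ≫ (ρ s).hom ≠ P ∧ P ≫ (ρ t).hom ≠ P :=
    fun P => ⟨hfree s hs1 P, hfree t ht1 P⟩
  exact exists_heckePrymDatum_F21_of_curve_free
    ⟨C, hC, (ρ s).hom, (ρ t).hom, h86, hσ7, hτ3, hστ, hfree', h6⟩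

/-- **`exists_heckePrymDatum_F21` from Riemann's existence theorem and the holomorphic Lefschetz
fixed-point formula — the complete reduction, no Jacobian fact needed.** `hRE`: Riemann's existence
theorem for free actions with prescribed group ([LangeRodriguez2022, Thm. 3.1.1]); `hL`: the holomorphic
Lefschetz formula for compact Kähler manifolds ([AtiyahBott1968, Thm. 4.12], VERBATIM the hypothesis of
`Surfaces.Nikulin_involution_eight_fixedPoints_of_holomorphicLefschetz_kaehler` and of
`exists_heckePrymDatum_F21_of_riemannExistence_of_holomorphicLefschetz`).  The trace input of the
previous theorem is `trace_hodgeZeroOne_restrict_eq_one_of_holomorphicLefschetz` (§1 of `…OfRiemannExistence`).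
[cite: LangeRodriguez2022, §3.1.2 Thm. 3.1.1 (PDF p. 52) and §3.5 Cor. 3.5.9–3.5.10 (PDF pp. 70–71)]
[cite: AtiyahBott1968, Part II Thm. 4.12 (holomorphic Lefschetz formula)] -/
theorem exists_heckePrymDatum_F21_of_riemannExistence_of_holomorphicLefschetz_free
    (hRE : ∀ (G : Type) [Group G] [Finite G] (g' : ℕ) (a b : Fin g' → G), 2 ≤ g' →
      Subgroup.closure (Set.range a ∪ Set.range b) = ⊤ →
      (List.ofFn fun i => a i * b i * (a i)⁻¹ * (b i)⁻¹).prod = 1 →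
      ∃ (C : Motives.SchemeOver ℂ) (_ : IsSmoothProjective 1 C) (ρ : G →* Aut C),
        (∀ g : G, g ≠ 1 → ∀ P : ComplexPoints C, P ≫ (ρ g).hom ≠ P) ∧
        Literature.NumberTheory.DiophantineGeometry.genus C = 1 + Nat.card G * (g' - 1))
    (hL : ∀ (E : Type) [NormedAddCommGroup E] [NormedSpace ℂ E] (M : Type) [TopologicalSpace M]
      [ChartedSpace E M] [FiniteDimensional ℂ E] [IsManifold 𝓘(ℂ, E) ω M]
      [IsManifold 𝓘(ℝ, E) ∞ M] [CompactSpace M] [T2Space M]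
      [Literature.Geometry.Kaehler.IsKaehlerManifold E M] (f : M → M)
      (hf : MDifferentiable 𝓘(ℂ, E) 𝓘(ℂ, E) f) (hf' : ContMDiff 𝓘(ℝ, E) 𝓘(ℝ, E) ∞ f)
      (hfin : {x | f x = x}.Finite),
      (∀ x, f x = x →
        LinearMap.det (LinearMap.id -
          ((mfderiv 𝓘(ℂ, E) 𝓘(ℂ, E) f x).toLinearMap : E →ₗ[ℂ] E)) ≠ 0) →
      ∑ q ∈ Finset.range (Module.finrank ℂ E + 1), (-1 : ℂ) ^ q *
          LinearMap.trace ℂ ↥(hodgePQ E M q 0 q)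
            ((complexDeRhamCohomology.map E hf' q).restrict
              fun u (hu : u ∈ hodgePQ E M q 0 q) => map_mem_hodgePQ hf' hf hu) =
        ∑ x ∈ hfin.toFinset,
          (LinearMap.det (LinearMap.id -
            ((mfderiv 𝓘(ℂ, E) 𝓘(ℂ, E) f x).toLinearMap : E →ₗ[ℂ] E)))⁻¹) :
    exists_heckePrymDatum_F21 :=
  exists_heckePrymDatum_F21_of_riemannExistence_of_traces_free hRE
    (fun _ hC σ _ hfree => trace_hodgeZeroOne_restrict_eq_one_of_holomorphicLefschetz hL hC σ.hom hfree)

end Literature.AlgebraicGeometry.HodgeTheory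

end
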